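/-
Copyright: cell pub-balaban-gaps (YM BLITZ Y1, track G1), seat g1-p2 GEN 5 (unit `pub-balaban-gaps-g1-p2`).  Row (D4) NODE O,
OBJECT ∕ MECHANISM level: RE-ROUTING a block walk expansion ONCE PER WALK — the σ-passage structure (`through`) obtained for a
whole walk from a GEOMETRIC letter (*"some localization domain of ω meets X, so the walk's distance passes within `s` of X"*)
at the price of ONE additive slack `s` in the walk distances (amplitudes `× e^{ρs}`, constant `× e^{εs}`), instead of routing
EVERY σ-carrying step through `X` (the per-step detour `e^{2ρr}` of `D4WalkBlockLocal.blockNorm_term_le` ∕ `B13DomainKernelWalks`,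
g1-plan-1 J33-2; RESIDUE (D4) v1.14 note (b) and «NOT ATTEMPTED (ii)»).  [B9] p. 427 (3.154): a localization meeting `Ωᶜ` costs
the factor (3.154) ONCE; [II] p. 16 (2.16): `dist(X, Z₀) > ⅔M` is used once per walk.
HONEST FRAMING: bookkeeping over a hypothesis shape; nothing of Bałaban's constructed; (D4) NOT discharged (instance 0∕1); NOT
BetaPertH, NOT continuum, NOT Clay.
-/
import Summits.QuantumFields.BalabanUV.Gaps.D4WalkBlock

/-!
# `Gaps.D4WalkBlockReroute` — `through` once per walk: re-routing a block walk expansion by an additive slack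
(cell pub-balaban-gaps, seat g1-p2 gen 5)

HONEST DEPENDENCY (cell pub-balaban, verbatim): continuum YM on T⁴ ⇐ BetaPertH ∧ nine spine estimates (0/9 proved);
BetaPertH ⇐ (D1) ∧ (D4) ∧ CAP+tail.

`blockWalkExpansion_reroute`: a block walk expansion (σ-region `X`, σ-carrying set `SX`) whose terms outside a set `M` of walks are
σ-independent at the reference configuration, and a GEOMETRIC letter `hnear : ∀ ω ∈ M, ∀ y y′, ∃ z ∈ X′, d₁(y,z) + d₁(z,y′) ≤ D_ω(y,y′) + s`
(`s ≥ 0`; for chains of domain-localised steps: a via point of a step whose domain meets `X′` is within the domain diameter of `X′`,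
`D4WalkBlockDecorateChains.exists_viaList`), give a block walk expansion with σ-region `X′`, σ-carrying set `M`, distances `D_ω + s`,
amplitudes `A_ω·e^{ρs}`, the same rates and window, constant `e^{εs}·K̄` — the detour paid ONCE.  With `D4WalkBlockDecorate` this is
the second half of print's walk bookkeeping (decorate once per parameter, route once per walk).
WHAT IT IS NOT: the chain-level `hnear` for the parametrix and the DECAYING block letter removing the flat-letter `e^{2ρr}` are separate
rungs; nothing of Bałaban's; (D4) instance 0∕1; words UNCHANGED.
-/

noncomputable section

namespace Summit.QuantumFields.BalabanUV.Gaps.D4WalkBlockReroute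

open Metric Set Finset
open Literature.MathematicalPhysics.QuantumFieldTheory.Balaban1983to89
open Literature.MathematicalPhysics.QuantumFieldTheory.Balaban1983to89.B9SectDWalk (Through MajSumLe DomBy)
open Literature.MathematicalPhysics.QuantumFieldTheory.Balaban1983to89.B9Thm34Ext (toB6)
open Literature.MathematicalPhysics.QuantumFieldTheory.Balaban1983to89.B9Thm37GlueTorus (torusGeom tdist1 tdist1_nonneg)
open Literature.MathematicalPhysics.QuantumFieldTheory.Balaban1983to89.TreeLengthTorus (TPt)
open Literature.MathematicalPhysics.QuantumFieldTheory.Balaban1983to89.B5TorusCover (UT)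
open Summit.QuantumFields.BalabanUV.Gaps.D4WalkBlock (blockNorm BlockWalkExpansion)

variable {d N' : ℕ} {ν : ℕ} {K : Fin ν → ℕ} [∀ i, NeZero (K i)]
variable {p n : Type} [Fintype p] [Fintype n]
variable {E : Type*} [NormedAddCommGroup E] [NormedSpace ℂ E]
variable {c₀ : B13.Consts} {cub : p → UT K} {cubn : n → UT K} {K2 : (TPt d N' → ℂ) → E → Matrix p n ℂ}
variable {X : Finset (UT K)} {R ε kap Kbar : ℝ}
variable {W : Type} {T2 : W → (TPt d N' → ℂ) → E → Matrix p n ℂ} {SX : Set W} {A : W → ℝ}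
variable {D : W → UT K → UT K → ℝ} {ρ : ℝ}

/-- **RE-ROUTING ONCE PER WALK.**  See the module docstring. [cite: Balaban1985BackgroundPropagators, (3.93) p.410, (3.154) p.427; Balaban1988RG2Cluster, p.13, (2.16) p.16] -/
theorem blockWalkExpansion_reroute (h : BlockWalkExpansion c₀ cub cubn K2 X R ε kap Kbar T2 SX A D ρ)
    (M : Set W) (X' : Finset (UT K)) {s : ℝ} (hs : 0 ≤ s)
    (hindep : ∀ ω, ω ∉ M → ∀ σ : TPt d N' → ℂ, (∀ j, ‖σ j‖ ≤ Real.exp c₀.κ₁) → T2 ω σ 0 = T2 ω 0 0)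
    (hnear : ∀ ω ∈ M, ∀ y y', ∃ z ∈ X', tdist1 K y z + tdist1 K z y' ≤ D ω y y' + s) :
    BlockWalkExpansion c₀ cub cubn K2 X' R ε kap (Real.exp (ε * s) * Kbar) T2 M (fun ω => A ω * Real.exp (ρ * s))
      (fun ω y y' => D ω y y' + s) ρ where
  hasSum := h.hasSum
  termAnalytic := h.termAnalytic
  majB ω σ hσ u hu y y' := by
    calc blockNorm cub cubn (T2 ω σ u) y y' ≤ A ω * Real.exp (-(ρ * D ω y y')) := h.majB ω σ hσ u hu y y'
      _ = (A ω * Real.exp (ρ * s)) * Real.exp (-(ρ * (D ω y y' + s))) := by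
          rw [mul_assoc, ← Real.exp_add]; ring_nf
  majSum S a b := by
    have h1 := h.majSum S a b
    have e : ∀ ω, (A ω * Real.exp (ρ * s)) * Real.exp (-((ρ - ε) * (D ω a b + s))) =
        Real.exp (ε * s) * (A ω * Real.exp (-((ρ - ε) * D ω a b))) := fun ω => by
      have : Real.exp (ρ * s) * Real.exp (-((ρ - ε) * (D ω a b + s))) = Real.exp (ε * s) * Real.exp (-((ρ - ε) * D ω a b)) := by
        rw [← Real.exp_add, ← Real.exp_add]; ring_nf
      calc (A ω * Real.exp (ρ * s)) * Real.exp (-((ρ - ε) * (D ω a b + s)))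
          = A ω * (Real.exp (ρ * s) * Real.exp (-((ρ - ε) * (D ω a b + s)))) := by ring
        _ = Real.exp (ε * s) * (A ω * Real.exp (-((ρ - ε) * D ω a b))) := by rw [this]; ring
    simp_rw [e]
    rw [← Finset.mul_sum]
    calc Real.exp (ε * s) * ∑ ω ∈ S, A ω * Real.exp (-((ρ - ε) * D ω a b))
        ≤ Real.exp (ε * s) * (Kbar * Real.exp (-(kap * tdist1 K a b))) := mul_le_mul_of_nonneg_left h1 (Real.exp_nonneg _)
      _ = Real.exp (ε * s) * Kbar * Real.exp (-(kap * tdist1 K a b)) := by ring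
  indep := hindep
  through ω hω y y' := hnear ω hω y y'
  A_nonneg ω := mul_nonneg (h.A_nonneg ω) (Real.exp_nonneg _)
  D_nonneg ω a b := add_nonneg (h.D_nonneg ω a b) hs

/-- The re-routed distances still dominate the cube distance (so products ∕ Neumann steps iterate). [cite: Balaban1984PropagatorsII, (2.54) p.233] -/
theorem domBy_reroute (hdom : ∀ ω, DomBy (toB6 (torusGeom K 0 0 0) 0 True) (D ω)) {s : ℝ} (hs : 0 ≤ s) (ω : W) :
    DomBy (toB6 (torusGeom K 0 0 0) 0 True) (fun y y' => D ω y y' + s) :=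
  fun y y' => (hdom ω y y').trans (le_add_of_nonneg_right hs)

end Summit.QuantumFields.BalabanUV.Gaps.D4WalkBlockReroute

end
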